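import Literature.LinearAlgebra.Matrix.IntegralConjugacyOfRegularElements
import HarnessLib

/-!
# Integral UNITARY conjugacy of regular elements: the unitary upgrade of Kottwitz's orbit lemma, modulo norm surjectivity on the
# commutant (Kottwitz, *Stable trace formula: elliptic singular terms* (1986), Prop. 7.1 for an unramified unitary group with its
# hyperspecial subgroup `K = U(J)(𝒪)`; Rogawski (1990), §3.3 p. 21)

Topic `LinearAlgebra/Matrix`; namespace `Literature.LinearAlgebra.Matrix`; THEOREMS ONLY (no definition, no instance, no named fact,
no `sorry`), Mathlib + ★ `IntegralConjugacyOfRegularElements` (the `GL_N` statement, F1).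

SETTING.  `A` a commutative ring with a ring involution `σ`, `J ∈ GL_m(A)` a `σ`-HERMITIAN matrix (`ᵗ(σJ) = J`, `det J ∈ Aˣ`); the
ADJOINT anti-involution of `M_m(A)` is `τ(X) = J⁻¹ · ᵗ(σX) · J` (spelled out everywhere — no definition is introduced), so that
`g` is `J`-unitary, `ᵗ(σg) J g = J` (the carrier condition of ★ `unitaryGroupOfForm σ J`, `Iff.rfl`), iff `τ(g) g = 1`.

THE UPGRADE (§2, `exists_integral_unitary_conj_of_conj`).  Let `γ, γ′ ∈ M_m(A)` be `J`-unitary and `γ′ k₀ = k₀ γ` with `k₀ ∈ GL_m(A)` (the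
output of ★ `exists_isUnit_det_conj_of_charpoly_eq`).  Then `b := τ(k₀) k₀` commutes with `γ`, is `τ`-fixed and invertible; IF the
norm equation `τ(c) c = b` has a solution `c` in the commutant of `γ` (hypothesis `hnorm`, «norm surjectivity on the `τ`-fixed units
of the commutant order `A[γ]`» — discharged for `A = 𝒪_w` complete with finite residue field and `p_γ` separable mod `𝔪_w` in the
companion file, from ★ `UnramifiedQuadraticNorm.exists_mul_map_eq_of_isReduced_quotient`), then `k := k₀ c⁻¹` is `J`-UNITARY, integral,
and still conjugates `γ` to `γ′`; moreover `k₀⁻¹ k = c⁻¹` centralises `γ`.  This is the step «γ′_v is conjugate to γ by an element of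
`K_v`» of [Rogawski1990, §3.3 p. 21] ∕ [Kottwitz1986, Prop. 7.1] for `G = U(J)`, `K = U(J)(𝒪)`, reduced to `GL_m` (F1) plus a norm
equation in the étale commutant.

* §1 the adjoint anti-involution: `hermAdjoint_mul` (`τ(XY) = τ(Y)τ(X)`), `hermAdjoint_one`, `hermAdjoint_hermAdjoint` (`τ² = id` for hermitian `J`),
  `hermAdjoint_mul_self_eq_one_iff` (`τ(g)g = 1 ↔ ᵗ(σg)Jg = J`), `isUnit_det_hermAdjoint`.
* §2 **`exists_integral_unitary_conj_of_conj`** (any `A`; hypothesis `hnorm`) and **`exists_integral_unitary_conj_of_charpoly_eq`** (`A = 𝒪` LOCAL, `p_γ`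
  separable mod `𝔪`, `p_δ = p_γ`, both unitary integral ⇒ `δ k = k γ` with `k` unitary integral — modulo `hnorm`).
* §3 **`exists_integral_unitary_map_mul_of_conj`** — the ORBIT form along `f : 𝒪 →+* F` injective intertwining the involutions (`𝒪_w ↪ E_w`):
  `y ∈ GL_m(F)` `J`-unitary with `y (γ ⊗ 1) y⁻¹` integral ⇒ `y = (k ⊗ 1) · z` with `k ∈ GL_m(𝒪)` `J`-UNITARY and `z` a `J`-unitary
  element of the centraliser of `γ ⊗ 1` (★ F1 `exists_isUnit_det_map_mul_of_conj` + §2) — i.e. `{y ∈ U(J)(F) ∣ yγy⁻¹ ∈ K} = K · U(J)(F)_γ`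
  with `K = U(J)(F) ∩ GL_m(𝒪)`, modulo `hnorm`.

What is NOT here: the discharge of `hnorm` (companion `IntegralUnitaryConjugacyComplete`); the `Subgroup` dress over ★
`unitaryGroupOfForm` ∕ ★ `glInt` and the CM a.e. assembly (consumer files under `NumberTheory/Automorphic`).

## References
* R. E. Kottwitz, *Stable trace formula: elliptic singular terms*, Math. Ann. 275 (1986), §7 Prop. 7.1, Cor. 7.3 [Kottwitz1986].
* J. D. Rogawski, *Automorphic Representations of Unitary Groups in Three Variables*, Ann. of Math. Stud. 123 (1990), §3.3 p. 21
  [Rogawski1990].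
* R. Jacobowitz, *Hermitian forms over local fields*, Amer. J. Math. 84 (1962), §2 (the adjoint involution of a hermitian space)
  [Jacobowitz1962].
-/

set_option autoImplicit false

open Matrix Polynomial

namespace Literature.LinearAlgebra.Matrix

/-! ## §1 The adjoint anti-involution `τ(X) = J⁻¹ ᵗ(σX) J` of a hermitian matrix -/

section Adjoint

variable {A : Type*} [CommRing A] (σ : A →+* A) {m : ℕ}

/-- `ᵗ(σ(XY)) = ᵗ(σY) ᵗ(σX)`. [cite: Jacobowitz1962, §2] -/
theorem sigmaTranspose_mul (X Y : Matrix (Fin m) (Fin m) A) :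
    ((X * Y).map σ)ᵀ = (Y.map σ)ᵀ * (X.map σ)ᵀ := by
  rw [Matrix.map_mul, Matrix.transpose_mul]

/-- **`τ(XY) = τ(Y) τ(X)`** for the adjoint `τ(X) = J⁻¹ ᵗ(σX) J` of an invertible `J`. [cite: Jacobowitz1962, §2] -/
theorem hermAdjoint_mul {J : Matrix (Fin m) (Fin m) A} (hJdet : IsUnit J.det) (X Y : Matrix (Fin m) (Fin m) A) :
    J⁻¹ * ((X * Y).map σ)ᵀ * J = (J⁻¹ * (Y.map σ)ᵀ * J) * (J⁻¹ * (X.map σ)ᵀ * J) := by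
  rw [sigmaTranspose_mul]
  calc J⁻¹ * ((Y.map σ)ᵀ * (X.map σ)ᵀ) * J = J⁻¹ * (Y.map σ)ᵀ * (J * J⁻¹) * (X.map σ)ᵀ * J := by
        rw [Matrix.mul_nonsing_inv J hJdet, Matrix.mul_one]; simp only [Matrix.mul_assoc]
    _ = (J⁻¹ * (Y.map σ)ᵀ * J) * (J⁻¹ * (X.map σ)ᵀ * J) := by simp only [Matrix.mul_assoc]

/-- `τ(1) = 1`. [cite: Jacobowitz1962, §2] -/
theorem hermAdjoint_one {J : Matrix (Fin m) (Fin m) A} (hJdet : IsUnit J.det) :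
    J⁻¹ * ((1 : Matrix (Fin m) (Fin m) A).map σ)ᵀ * J = 1 := by
  rw [Matrix.map_one σ (map_zero σ) (map_one σ), Matrix.transpose_one, Matrix.mul_one, Matrix.nonsing_inv_mul J hJdet]

/-- `ᵗ(σ(X⁻¹)) = (ᵗ(σX))⁻¹` for invertible `X`. [cite: Jacobowitz1962, §2] -/
theorem sigmaTranspose_nonsing_inv {X : Matrix (Fin m) (Fin m) A} (hX : IsUnit X.det) :
    (X⁻¹.map σ)ᵀ = ((X.map σ)ᵀ)⁻¹ := by
  symm
  apply Matrix.inv_eq_left_inv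
  rw [← sigmaTranspose_mul, Matrix.mul_nonsing_inv X hX, Matrix.map_one σ (map_zero σ) (map_one σ), Matrix.transpose_one]

/-- For a `σ`-hermitian invertible `J`: `ᵗ(σ(J⁻¹)) = J⁻¹`. [cite: Jacobowitz1962, §2] -/
theorem sigmaTranspose_nonsing_inv_of_hermitian {J : Matrix (Fin m) (Fin m) A} (hJ : (J.map σ)ᵀ = J)
    (hJdet : IsUnit J.det) : (J⁻¹.map σ)ᵀ = J⁻¹ := by
  rw [sigmaTranspose_nonsing_inv σ hJdet, hJ]

/-- **`τ(τ(X)) = X`**: the adjoint of a `σ`-hermitian invertible `J` (for an involution `σ`) is an involution.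
[cite: Jacobowitz1962, §2] -/
theorem hermAdjoint_hermAdjoint (hσ : ∀ a, σ (σ a) = a) {J : Matrix (Fin m) (Fin m) A} (hJ : (J.map σ)ᵀ = J) (hJdet : IsUnit J.det)
    (X : Matrix (Fin m) (Fin m) A) : J⁻¹ * ((J⁻¹ * (X.map σ)ᵀ * J).map σ)ᵀ * J = X := by
  have hXX : ((X.map σ)ᵀ.map σ)ᵀ = X := by
    rw [Matrix.transpose_map, Matrix.transpose_transpose, Matrix.map_map]
    have : (σ ∘ σ : A → A) = id := funext hσ
    rw [this, Matrix.map_id]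
  rw [Matrix.map_mul, Matrix.map_mul, Matrix.transpose_mul, Matrix.transpose_mul, hJ, hXX,
    sigmaTranspose_nonsing_inv_of_hermitian σ hJ hJdet]
  calc J⁻¹ * (J * (X * J⁻¹)) * J = (J⁻¹ * J) * X * (J⁻¹ * J) := by simp only [Matrix.mul_assoc]
    _ = X := by rw [Matrix.nonsing_inv_mul J hJdet, Matrix.one_mul, Matrix.mul_one]

/-- **Unitarity through the adjoint**: `ᵗ(σg) J g = J ↔ τ(g) g = 1` (`J` invertible) — the carrier condition of ★
`unitaryGroupOfForm σ J` read as `τ(g) = g⁻¹`. [cite: Kottwitz1986, §7 (the hyperspecial `K = G(𝒪)`)] -/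
theorem hermAdjoint_mul_self_eq_one_iff {J : Matrix (Fin m) (Fin m) A} (hJdet : IsUnit J.det) (g : Matrix (Fin m) (Fin m) A) :
    J⁻¹ * (g.map σ)ᵀ * J * g = 1 ↔ (g.map σ)ᵀ * J * g = J := by
  constructor
  · intro h
    calc (g.map σ)ᵀ * J * g = J * (J⁻¹ * (g.map σ)ᵀ * J * g) := by
          rw [show J⁻¹ * (g.map σ)ᵀ * J * g = J⁻¹ * ((g.map σ)ᵀ * J * g) by simp only [Matrix.mul_assoc],
            Matrix.mul_nonsing_inv_cancel_left J _ hJdet]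
      _ = J := by rw [h, Matrix.mul_one]
  · intro h
    rw [show J⁻¹ * (g.map σ)ᵀ * J * g = J⁻¹ * ((g.map σ)ᵀ * J * g) by simp only [Matrix.mul_assoc], h,
      Matrix.nonsing_inv_mul J hJdet]

/-- `τ(X)` is invertible when `X` is. [cite: Jacobowitz1962, §2] -/
theorem isUnit_det_hermAdjoint {J : Matrix (Fin m) (Fin m) A} (hJdet : IsUnit J.det) {X : Matrix (Fin m) (Fin m) A}
    (hX : IsUnit X.det) : IsUnit (J⁻¹ * (X.map σ)ᵀ * J).det := by
  rw [Matrix.det_mul, Matrix.det_mul, Matrix.det_transpose]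
  refine (IsUnit.mul ?_ ?_).mul hJdet
  · exact Matrix.isUnit_nonsing_inv_det_iff.mpr hJdet
  · rw [← RingHom.mapMatrix_apply, ← RingHom.map_det]
    exact hX.map σ

/-- The adjoint is additive: `τ(X + Y) = τ(X) + τ(Y)`. [cite: Jacobowitz1962, §2] -/
theorem hermAdjoint_add (J X Y : Matrix (Fin m) (Fin m) A) :
    J⁻¹ * ((X + Y).map σ)ᵀ * J = J⁻¹ * (X.map σ)ᵀ * J + J⁻¹ * (Y.map σ)ᵀ * J := by
  rw [Matrix.map_add σ (map_add σ), Matrix.transpose_add, Matrix.mul_add, Matrix.add_mul]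

/-- The adjoint is `σ`-semilinear: `τ(a • X) = σ(a) • τ(X)`. [cite: Jacobowitz1962, §2] -/
theorem hermAdjoint_smul (J : Matrix (Fin m) (Fin m) A) (a : A) (X : Matrix (Fin m) (Fin m) A) :
    J⁻¹ * ((a • X).map σ)ᵀ * J = σ a • (J⁻¹ * (X.map σ)ᵀ * J) := by
  have h : (a • X).map σ = σ a • X.map σ := by
    ext i j
    simp only [Matrix.map_apply, Matrix.smul_apply, smul_eq_mul, map_mul]
  rw [h, Matrix.transpose_smul, Matrix.mul_smul, Matrix.smul_mul]

/-- **The adjoint preserves the commutant of a unitary element**: if `γ` is `J`-unitary (`J` invertible) and `b` commutes with `γ`, then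
`τ(b)` commutes with `γ` (`τ(b)` commutes with `τ(γ) = γ⁻¹`). [cite: Kottwitz1986, §7 Prop. 7.1] -/
theorem commute_hermAdjoint_of_commute {J γ b : Matrix (Fin m) (Fin m) A} (hJdet : IsUnit J.det)
    (hγU : (γ.map σ)ᵀ * J * γ = J) (hb : Commute γ b) : Commute γ (J⁻¹ * (b.map σ)ᵀ * J) := by
  have hγ1 : J⁻¹ * (γ.map σ)ᵀ * J * γ = 1 := (hermAdjoint_mul_self_eq_one_iff σ hJdet γ).2 hγU
  have hγ1' : γ * (J⁻¹ * (γ.map σ)ᵀ * J) = 1 := mul_eq_one_comm.1 hγ1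
  -- `τ b · τ γ = τ (γ b) = τ (b γ) = τ γ · τ b`
  have hc : J⁻¹ * (b.map σ)ᵀ * J * (J⁻¹ * (γ.map σ)ᵀ * J) = J⁻¹ * (γ.map σ)ᵀ * J * (J⁻¹ * (b.map σ)ᵀ * J) := by
    rw [← hermAdjoint_mul σ hJdet, ← hermAdjoint_mul σ hJdet, hb.eq]
  change γ * (J⁻¹ * (b.map σ)ᵀ * J) = J⁻¹ * (b.map σ)ᵀ * J * γ
  calc γ * (J⁻¹ * (b.map σ)ᵀ * J) = γ * (J⁻¹ * (b.map σ)ᵀ * J) * (J⁻¹ * (γ.map σ)ᵀ * J * γ) := by rw [hγ1, Matrix.mul_one]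
    _ = γ * (J⁻¹ * (b.map σ)ᵀ * J * (J⁻¹ * (γ.map σ)ᵀ * J)) * γ := by simp only [Matrix.mul_assoc]
    _ = γ * (J⁻¹ * (γ.map σ)ᵀ * J) * (J⁻¹ * (b.map σ)ᵀ * J) * γ := by rw [hc]; simp only [Matrix.mul_assoc]
    _ = J⁻¹ * (b.map σ)ᵀ * J * γ := by rw [hγ1', Matrix.one_mul]

/-- **Products of `J`-unitary matrices are `J`-unitary.** [cite: Kottwitz1986, §7] -/
theorem formUnitary_mul {J g h : Matrix (Fin m) (Fin m) A} (hg : (g.map σ)ᵀ * J * g = J) (hh : (h.map σ)ᵀ * J * h = J) :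
    ((g * h).map σ)ᵀ * J * (g * h) = J := by
  rw [sigmaTranspose_mul]
  calc (h.map σ)ᵀ * (g.map σ)ᵀ * J * (g * h) = (h.map σ)ᵀ * ((g.map σ)ᵀ * J * g) * h := by
        simp only [Matrix.mul_assoc]
    _ = J := by rw [hg, hh]

/-- **Inverses of invertible `J`-unitary matrices are `J`-unitary.** [cite: Kottwitz1986, §7] -/
theorem formUnitary_nonsing_inv {J g : Matrix (Fin m) (Fin m) A} (hgdet : IsUnit g.det) (hg : (g.map σ)ᵀ * J * g = J) :
    (g⁻¹.map σ)ᵀ * J * g⁻¹ = J := by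
  have hgt : IsUnit ((g.map σ)ᵀ).det := by
    rw [Matrix.det_transpose, ← RingHom.mapMatrix_apply, ← RingHom.map_det]; exact hgdet.map σ
  rw [sigmaTranspose_nonsing_inv σ hgdet]
  have h1 : ((g.map σ)ᵀ)⁻¹ * J = J * g := by
    calc ((g.map σ)ᵀ)⁻¹ * J = ((g.map σ)ᵀ)⁻¹ * ((g.map σ)ᵀ * J * g) := by rw [hg]
      _ = J * g := by
        rw [Matrix.mul_assoc ((g.map σ)ᵀ), Matrix.nonsing_inv_mul_cancel_left _ _ hgt]
  rw [h1, Matrix.mul_nonsing_inv_cancel_right g _ hgdet]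

/-- If `c` commutes with `γ` and is invertible then `c⁻¹` commutes with `γ`. [cite: Kottwitz1986, §7] -/
theorem nonsing_inv_mul_eq_mul_nonsing_inv_of_commute {γ c : Matrix (Fin m) (Fin m) A} (hc : IsUnit c.det)
    (h : Commute γ c) : c⁻¹ * γ = γ * c⁻¹ := by
  calc c⁻¹ * γ = c⁻¹ * γ * (c * c⁻¹) := by rw [Matrix.mul_nonsing_inv c hc, Matrix.mul_one]
    _ = c⁻¹ * (γ * c) * c⁻¹ := by simp only [Matrix.mul_assoc]
    _ = c⁻¹ * (c * γ) * c⁻¹ := by rw [h.eq]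
    _ = γ * c⁻¹ := by rw [← Matrix.mul_assoc, Matrix.nonsing_inv_mul c hc, Matrix.one_mul]

end Adjoint

/-! ## §2 The unitary upgrade modulo norm surjectivity on the commutant -/

section Upgrade

variable {A : Type*} [CommRing A] (σ : A →+* A) {m : ℕ}

/-- **The unitary upgrade of an integral conjugacy** (Kottwitz's Prop. 7.1 for `U(J)`, algebraic core).  `σ` an involution of `A`,
`J` `σ`-hermitian invertible, `γ, γ′ ∈ M_m(A)` `J`-unitary with `γ′ k₀ = k₀ γ` for some `k₀ ∈ GL_m(A)`.  ASSUME norm surjectivity on the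
commutant of `γ`: every `τ`-fixed invertible `b` commuting with `γ` is `τ(c) c` for some `c` commuting with `γ` (`τ(X) = J⁻¹ ᵗ(σX) J`).
THEN `γ′ k = k γ` for some `J`-UNITARY `k ∈ GL_m(A)` with `k₀⁻¹ k` in the commutant of `γ` (so `k γ k⁻¹ = k₀ γ k₀⁻¹`).  Proof: `b := τ(k₀) k₀`
qualifies (`γ′` unitary forces `τ(k₀) γ′ = γ τ(k₀)`), take `τ(c) c = b` and `k := k₀ c⁻¹`. [cite: Kottwitz1986, §7 Prop. 7.1]
[cite: Rogawski1990, §3.3 p. 21] -/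
theorem exists_integral_unitary_conj_of_conj (hσ : ∀ a, σ (σ a) = a) {J : Matrix (Fin m) (Fin m) A} (hJ : (J.map σ)ᵀ = J)
    (hJdet : IsUnit J.det) {γ γ' k₀ : Matrix (Fin m) (Fin m) A} (hk₀ : IsUnit k₀.det)
    (hγU : (γ.map σ)ᵀ * J * γ = J) (hγ'U : (γ'.map σ)ᵀ * J * γ' = J) (h : γ' * k₀ = k₀ * γ)
    (hnorm : ∀ b : Matrix (Fin m) (Fin m) A, Commute γ b → IsUnit b.det → J⁻¹ * (b.map σ)ᵀ * J = b →
      ∃ c : Matrix (Fin m) (Fin m) A, Commute γ c ∧ J⁻¹ * (c.map σ)ᵀ * J * c = b) :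
    ∃ k : Matrix (Fin m) (Fin m) A, IsUnit k.det ∧ (k.map σ)ᵀ * J * k = J ∧ γ' * k = k * γ ∧ Commute γ (k₀⁻¹ * k) := by
  -- the adjoint, as an opaque local function `T`
  obtain ⟨T, hT⟩ : ∃ T : Matrix (Fin m) (Fin m) A → Matrix (Fin m) (Fin m) A, ∀ X, T X = J⁻¹ * (X.map σ)ᵀ * J :=
    ⟨_, fun _ => rfl⟩
  have Tmul : ∀ X Y, T (X * Y) = T Y * T X := fun X Y => by rw [hT, hT, hT]; exact hermAdjoint_mul σ hJdet X Y
  have TT : ∀ X, T (T X) = X := fun X => by rw [hT, hT]; exact hermAdjoint_hermAdjoint σ hσ hJ hJdet X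
  have T1 : T 1 = 1 := by rw [hT]; exact hermAdjoint_one σ hJdet
  -- unitarity: `T γ γ = 1`, `γ T γ = 1`, `T γ′ γ′ = 1`
  have hγ1 : T γ * γ = 1 := by rw [hT]; exact (hermAdjoint_mul_self_eq_one_iff σ hJdet γ).2 hγU
  have hγ1' : γ * T γ = 1 := mul_eq_one_comm.1 hγ1
  have hγ'1 : T γ' * γ' = 1 := by rw [hT]; exact (hermAdjoint_mul_self_eq_one_iff σ hJdet γ').2 hγ'U
  -- `T k₀ γ′ = γ T k₀`
  have hE1 : T k₀ * T γ' = T γ * T k₀ := by rw [← Tmul, ← Tmul, h]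
  have hE2 : T k₀ * γ' = γ * T k₀ := by
    calc T k₀ * γ' = γ * T γ * T k₀ * γ' := by rw [hγ1', Matrix.one_mul]
      _ = γ * (T k₀ * T γ') * γ' := by rw [hE1]; simp only [Matrix.mul_assoc]
      _ = γ * T k₀ * (T γ' * γ') := by simp only [Matrix.mul_assoc]
      _ = γ * T k₀ := by rw [hγ'1, Matrix.mul_one]
  -- `b := T k₀ k₀` commutes with `γ`, is `T`-fixed and invertible
  obtain ⟨b, hb⟩ : ∃ b : Matrix (Fin m) (Fin m) A, b = T k₀ * k₀ := ⟨_, rfl⟩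
  have hbγ : Commute γ b := by
    rw [hb]
    change γ * (T k₀ * k₀) = T k₀ * k₀ * γ
    calc γ * (T k₀ * k₀) = (γ * T k₀) * k₀ := by rw [Matrix.mul_assoc]
      _ = T k₀ * (γ' * k₀) := by rw [← hE2, Matrix.mul_assoc]
      _ = T k₀ * k₀ * γ := by rw [h, Matrix.mul_assoc]
  have hTb : T b = b := by rw [hb, Tmul, TT]
  have hTk₀ : IsUnit (T k₀).det := by rw [hT]; exact isUnit_det_hermAdjoint σ hJdet hk₀
  have hbdet : IsUnit b.det := by rw [hb, Matrix.det_mul]; exact hTk₀.mul hk₀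
  -- solve the norm equation in the commutant
  have hTb' : J⁻¹ * (b.map σ)ᵀ * J = b := by rw [← hT]; exact hTb
  obtain ⟨c, hcγ, hcb⟩ := hnorm b hbγ hbdet hTb'
  rw [← hT] at hcb
  have hc : IsUnit c.det := by
    apply Matrix.isUnit_det_of_left_inverse (B := b⁻¹ * T c)
    rw [Matrix.mul_assoc, hcb, Matrix.nonsing_inv_mul b hbdet]
  have hcc : c * c⁻¹ = 1 := Matrix.mul_nonsing_inv c hc
  have hcγ' : c⁻¹ * γ = γ * c⁻¹ := nonsing_inv_mul_eq_mul_nonsing_inv_of_commute hc hcγ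
  refine ⟨k₀ * c⁻¹, ?_, ?_, ?_, ?_⟩
  · rw [Matrix.det_mul]
    exact hk₀.mul (Matrix.isUnit_nonsing_inv_det_iff.mpr hc)
  · -- unitarity: `T(k₀ c⁻¹) k₀ c⁻¹ = T(c⁻¹) (T k₀ k₀) c⁻¹ = T(c⁻¹) T c c c⁻¹ = 1`
    rw [← hermAdjoint_mul_self_eq_one_iff σ hJdet, ← hT]
    have hTc : T c⁻¹ * T c = 1 := by rw [← Tmul, hcc, T1]
    calc T (k₀ * c⁻¹) * (k₀ * c⁻¹) = T c⁻¹ * (T k₀ * k₀) * c⁻¹ := by rw [Tmul]; simp only [Matrix.mul_assoc]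
      _ = T c⁻¹ * (T c * c) * c⁻¹ := by rw [← hb, ← hcb]
      _ = (T c⁻¹ * T c) * (c * c⁻¹) := by simp only [Matrix.mul_assoc]
      _ = 1 := by rw [hTc, hcc, Matrix.mul_one]
  · -- `γ′ k₀ c⁻¹ = k₀ γ c⁻¹ = k₀ c⁻¹ γ`
    rw [← Matrix.mul_assoc, h, Matrix.mul_assoc, ← hcγ', Matrix.mul_assoc]
  · -- `k₀⁻¹ (k₀ c⁻¹) = c⁻¹`
    rw [Matrix.nonsing_inv_mul_cancel_left k₀ _ hk₀]
    exact hcγ'.symm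

variable {𝒪 : Type*} [CommRing 𝒪] [IsLocalRing 𝒪] (σ𝒪 : 𝒪 →+* 𝒪)

/-- **Integral unitary conjugacy of regular elements with equal characteristic polynomial** (Kottwitz's Prop. 7.1 for `U(J)`, two
integral points): over a LOCAL ring `𝒪` with involution `σ` and `σ`-hermitian invertible `J`, two `J`-unitary `γ, δ ∈ M_m(𝒪)` with
`p_δ = p_γ` separable modulo `𝔪` are conjugate by a `J`-UNITARY `k ∈ GL_m(𝒪)`: `δ k = k γ` — modulo norm surjectivity on the commutant of
`γ` (`hnorm`).  (★ `exists_isUnit_det_conj_of_charpoly_eq` + `exists_integral_unitary_conj_of_conj`.) [cite: Kottwitz1986, §7 Prop. 7.1]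
[cite: Rogawski1990, §3.3 p. 21] -/
theorem exists_integral_unitary_conj_of_charpoly_eq (hσ : ∀ a, σ𝒪 (σ𝒪 a) = a) {J : Matrix (Fin m) (Fin m) 𝒪} (hJ : (J.map σ𝒪)ᵀ = J)
    (hJdet : IsUnit J.det) {γ δ : Matrix (Fin m) (Fin m) 𝒪}
    (hsep : (γ.charpoly.map (IsLocalRing.residue 𝒪)).Separable) (hchar : δ.charpoly = γ.charpoly)
    (hγU : (γ.map σ𝒪)ᵀ * J * γ = J) (hδU : (δ.map σ𝒪)ᵀ * J * δ = J)
    (hnorm : ∀ b : Matrix (Fin m) (Fin m) 𝒪, Commute γ b → IsUnit b.det → J⁻¹ * (b.map σ𝒪)ᵀ * J = b →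
      ∃ c : Matrix (Fin m) (Fin m) 𝒪, Commute γ c ∧ J⁻¹ * (c.map σ𝒪)ᵀ * J * c = b) :
    ∃ k : Matrix (Fin m) (Fin m) 𝒪, IsUnit k.det ∧ (k.map σ𝒪)ᵀ * J * k = J ∧ δ * k = k * γ := by
  obtain ⟨P, hP, hδP⟩ := exists_isUnit_det_conj_of_charpoly_eq γ δ hsep hchar
  obtain ⟨k, hk, hkU, hδk, -⟩ := exists_integral_unitary_conj_of_conj σ𝒪 hσ hJ hJdet hP hγU hδU hδP hnorm
  exact ⟨k, hk, hkU, hδk⟩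

end Upgrade

/-! ## §3 The orbit form along `f : 𝒪 →+* F`: `y (γ ⊗ 1) y⁻¹` integral, `y` unitary ⇒ `y ∈ K · U(J)(F)_γ` -/

section Orbit

variable {𝒪 : Type*} [CommRing 𝒪] {F : Type*} [CommRing F] {m : ℕ}

/-- Unitarity descends along an injective `f : 𝒪 →+* F` intertwining the involutions: if `g ⊗ 1` is `(σ_F, J ⊗ 1)`-unitary then `g` is
`(σ_𝒪, J)`-unitary. [cite: Kottwitz1986, §7 Prop. 7.1] -/
theorem formUnitary_of_formUnitary_map (f : 𝒪 →+* F) (hf : Function.Injective f) {σ𝒪 : 𝒪 →+* 𝒪} {σF : F →+* F}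
    (hfσ : ∀ x, f (σ𝒪 x) = σF (f x)) {J g : Matrix (Fin m) (Fin m) 𝒪}
    (h : ((g.map f).map σF)ᵀ * J.map f * g.map f = J.map f) : (g.map σ𝒪)ᵀ * J * g = J := by
  apply Matrix.map_injective hf
  have hcomp : (σF ∘ f : 𝒪 → F) = (f ∘ σ𝒪 : 𝒪 → F) := funext fun x => (hfσ x).symm
  change ((g.map σ𝒪)ᵀ * J * g).map f = J.map f
  rw [Matrix.map_mul, Matrix.map_mul, Matrix.transpose_map, Matrix.map_map, ← hcomp, ← Matrix.map_map]
  exact h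

/-- Unitarity ascends along `f`: if `g` is `(σ_𝒪, J)`-unitary then `g ⊗ 1` is `(σ_F, J ⊗ 1)`-unitary. [cite: Kottwitz1986, §7 Prop. 7.1] -/
theorem formUnitary_map_of_formUnitary (f : 𝒪 →+* F) {σ𝒪 : 𝒪 →+* 𝒪} {σF : F →+* F} (hfσ : ∀ x, f (σ𝒪 x) = σF (f x))
    {J g : Matrix (Fin m) (Fin m) 𝒪} (h : (g.map σ𝒪)ᵀ * J * g = J) :
    ((g.map f).map σF)ᵀ * J.map f * g.map f = J.map f := by
  have hcomp : (σF ∘ f : 𝒪 → F) = (f ∘ σ𝒪 : 𝒪 → F) := funext fun x => (hfσ x).symm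
  rw [Matrix.map_map, hcomp, ← Matrix.map_map, ← Matrix.transpose_map, ← Matrix.map_mul, ← Matrix.map_mul, h]

variable [IsLocalRing 𝒪]

/-- **Kottwitz's orbit lemma for `U(J)` with `K = U(J)(F) ∩ GL_m(𝒪)`, modulo norm surjectivity on the commutant.**  `f : 𝒪 →+* F` injective
from a local ring, intertwining the involutions `σ_𝒪, σ_F`; `J ∈ GL_m(𝒪)` `σ_𝒪`-hermitian; `γ ∈ M_m(𝒪)` `J`-unitary with `p_γ` separable
modulo `𝔪` and satisfying `hnorm`; `y ∈ GL_m(F)` `(σ_F, J ⊗ 1)`-unitary with `y (γ ⊗ 1) = (g′ ⊗ 1) y` for some integral `g′`.  Then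
`y = (k ⊗ 1) · z` with `k ∈ GL_m(𝒪)` `J`-UNITARY and `z ∈ GL_m(F)` `J`-unitary commuting with `γ ⊗ 1` — «`{y ∣ y γ y⁻¹ ∈ K} = K · G_γ(F)`»
for `G = U(J)`. (★ F1 `exists_isUnit_det_map_mul_of_conj`, then `exists_integral_unitary_conj_of_conj` on the integral conjugator.)
[cite: Kottwitz1986, §7 Prop. 7.1, Cor. 7.3] [cite: Rogawski1990, §3.3 p. 21] -/
theorem exists_integral_unitary_map_mul_of_conj (f : 𝒪 →+* F) (hf : Function.Injective f) {σ𝒪 : 𝒪 →+* 𝒪} {σF : F →+* F}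
    (hfσ : ∀ x, f (σ𝒪 x) = σF (f x)) (hσ : ∀ a, σ𝒪 (σ𝒪 a) = a) {J : Matrix (Fin m) (Fin m) 𝒪} (hJ : (J.map σ𝒪)ᵀ = J)
    (hJdet : IsUnit J.det) {γ g' : Matrix (Fin m) (Fin m) 𝒪} (hγU : (γ.map σ𝒪)ᵀ * J * γ = J)
    (hsep : (γ.charpoly.map (IsLocalRing.residue 𝒪)).Separable)
    (hnorm : ∀ b : Matrix (Fin m) (Fin m) 𝒪, Commute γ b → IsUnit b.det → J⁻¹ * (b.map σ𝒪)ᵀ * J = b →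
      ∃ c : Matrix (Fin m) (Fin m) 𝒪, Commute γ c ∧ J⁻¹ * (c.map σ𝒪)ᵀ * J * c = b)
    {y : Matrix (Fin m) (Fin m) F} (hy : IsUnit y.det) (hyU : (y.map σF)ᵀ * J.map f * y = J.map f)
    (h : y * γ.map f = g'.map f * y) :
    ∃ (k : Matrix (Fin m) (Fin m) 𝒪) (z : Matrix (Fin m) (Fin m) F), IsUnit k.det ∧ (k.map σ𝒪)ᵀ * J * k = J ∧
      IsUnit z.det ∧ z * γ.map f = γ.map f * z ∧ (z.map σF)ᵀ * J.map f * z = J.map f ∧ y = k.map f * z := by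
  obtain ⟨k₀, z₀, hk₀, hz₀, hz₀γ, hyz₀⟩ := exists_isUnit_det_map_mul_of_conj f hf hsep hy h
  have hk₀f : IsUnit (k₀.map f).det := by
    rw [← RingHom.mapMatrix_apply, ← RingHom.map_det]; exact hk₀.map f
  -- `g′ k₀ = k₀ γ` over `𝒪`: cancel the unit `z₀` and use injectivity of `f`
  have hconj : g' * k₀ = k₀ * γ := by
    apply Matrix.map_injective hf
    change (g' * k₀).map f = (k₀ * γ).map f
    rw [Matrix.map_mul, Matrix.map_mul]
    have h1 : g'.map f * k₀.map f * z₀ = k₀.map f * γ.map f * z₀ := by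
      rw [Matrix.mul_assoc, ← hyz₀, ← h, hyz₀, Matrix.mul_assoc, hz₀γ, ← Matrix.mul_assoc]
    calc g'.map f * k₀.map f = g'.map f * k₀.map f * z₀ * z₀⁻¹ := by rw [Matrix.mul_nonsing_inv_cancel_right z₀ _ hz₀]
      _ = k₀.map f * γ.map f := by rw [h1, Matrix.mul_nonsing_inv_cancel_right z₀ _ hz₀]
  -- `g′` is unitary over `𝒪`: `g′ ⊗ 1 = y (γ ⊗ 1) y⁻¹` is a product of unitaries over `F`
  have hg'f : g'.map f = y * γ.map f * y⁻¹ := by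
    rw [h, Matrix.mul_nonsing_inv_cancel_right y _ hy]
  have hg'U : (g'.map σ𝒪)ᵀ * J * g' = J := by
    apply formUnitary_of_formUnitary_map f hf hfσ
    rw [hg'f]
    exact formUnitary_mul σF (formUnitary_mul σF hyU (formUnitary_map_of_formUnitary f hfσ hγU)) (formUnitary_nonsing_inv σF hy hyU)
  -- upgrade the integral conjugator
  obtain ⟨k, hk, hkU, -, hkγ⟩ := exists_integral_unitary_conj_of_conj σ𝒪 hσ hJ hJdet hk₀ hγU hg'U hconj hnorm
  have hkf : IsUnit (k.map f).det := by rw [← RingHom.mapMatrix_apply, ← RingHom.map_det]; exact hk.map f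
  -- `k = k₀ u` with `u` in the commutant of `γ`
  obtain ⟨u, hu, hku⟩ : ∃ u : Matrix (Fin m) (Fin m) 𝒪, Commute γ u ∧ k = k₀ * u :=
    ⟨k₀⁻¹ * k, hkγ, (Matrix.mul_nonsing_inv_cancel_left k₀ k hk₀).symm⟩
  have hudet : IsUnit u.det := by
    have hdet : k.det = k₀.det * u.det := by rw [hku, Matrix.det_mul]
    exact isUnit_of_mul_isUnit_right (hdet ▸ hk)
  have huf : IsUnit (u.map f).det := by rw [← RingHom.mapMatrix_apply, ← RingHom.map_det]; exact hudet.map f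
  have hufγ : Commute (γ.map f) (u.map f) := by
    change γ.map f * u.map f = u.map f * γ.map f
    rw [← Matrix.map_mul, ← Matrix.map_mul, hu.eq]
  -- `z := (k ⊗ 1)⁻¹ y = (u ⊗ 1)⁻¹ z₀`
  have hz : (k.map f)⁻¹ * y = (u.map f)⁻¹ * z₀ := by
    rw [hyz₀, hku, Matrix.map_mul, Matrix.mul_inv_rev, Matrix.mul_assoc,
      Matrix.nonsing_inv_mul_cancel_left (k₀.map f) _ hk₀f]
  refine ⟨k, (k.map f)⁻¹ * y, hk, hkU, ?_, ?_, ?_, ?_⟩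
  · rw [Matrix.det_mul]; exact (Matrix.isUnit_nonsing_inv_det_iff.mpr hkf).mul hy
  · rw [hz, Matrix.mul_assoc, hz₀γ, ← Matrix.mul_assoc, nonsing_inv_mul_eq_mul_nonsing_inv_of_commute huf hufγ,
      Matrix.mul_assoc]
  · exact formUnitary_mul σF (formUnitary_nonsing_inv σF hkf (formUnitary_map_of_formUnitary f hfσ hkU)) hyU
  · rw [Matrix.mul_nonsing_inv_cancel_left _ _ hkf]

end Orbit

end Literature.LinearAlgebra.Matrix
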